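import Summits.QuantumFields.BalabanUV.Beta.EriceRemainderEnclosureHistoryAutonomyAsymptoticDiscrepancy

/-!
# EriceRemainderEnclosureHistoryAutonomySolutionSet — (E44b) THE SOLUTION SET OF ONE FLOW IS A COMPACT LINE SET: for ANY functional with a
# zeroth moment (any size) and a floor on ]0,γ], the set of box solutions of the flow with memory from one pin `g_IR ∈ ]0,γ]` is COMPACT in
# the product topology of `ℕ → ℝ`; its image under (E44a)'s classifying number `h ↦ D_∞(h, h₀)` is a COMPACT subset of `[−K, K]`; agewise
# convergence of solutions is EQUIVALENT to convergence of the classifying numbers (a sequential homeomorphism onto the image); and there are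
# EXTREMAL solutions — one eventually below every other solution, one eventually above

Cell `pub-balaban`, β-function sub-cell, BINDER row D4 «RemainderConst leaves for Bałaban's split» (`HOME/BINDER-OWNERS.md`; owner
lineage `b2b-balaban-beta-an4`; this file by co-owner #2 lineage `b2b-balaban-beta-d4-p2`, generation 41), β-FLOW TEAM duty (1),
FREEZE (0) honoured (def-free; (E44a) `…HistoryAutonomyAsymptoticDiscrepancy`, (E40) `…HistoryAutonomyContinuity.exists_memFlow_limit_point` and
(E37b) `…HistoryAutonomyWellPosed.le_upper_zm` BY NAME).

HONEST FRAMING (page 1, verbatim and binding).  *"Discharging BetaPertH makes Bałaban's UV stability UNCONDITIONAL — a real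
constructive-QFT result; it is NOT the continuum limit and NOT the Clay problem."*  THIS FILE DISCHARGES NOTHING OF THE KIND.  Elementary
topology (Bolzano–Weierstrass in metrizable spaces, `IsSeqCompact.isCompact`; extrema on compact sets) over the cell's own NOT-IN-PRINT binder
shapes; nothing of Bałaban's (1.22) ∕ its limit functional asserted (GAPS G-t4-U2-1∕-2).  Row D4 class UNCHANGED (critical-path width 0;
instance 0∕1; D4 DISCHARGE NO DATE).  HONEST DEPENDENCY: continuum YM on T⁴ ⇐ BetaPertH ∧ nine spine estimates (0/9 proved); BetaPertH ⇐
(D1) ∧ (D4) ∧ CAP+tail; G-an2-4 gates asym, D1 and NE2/3/4.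

THE POINT (census sense (α)).  (E40) proved the solution set upper semicontinuous along agewise limits (a sequential statement); (E44a)
gave the injective, sequentially continuous classifying number `D_∞(·, h₀)`.  HERE the two are assembled into the structure statement:
(§1) the solution set `{h | SeqBox γ h ∧ MemFlow B g_IR h}` of ONE flow is COMPACT in `ℕ → ℝ` (countable product ⟹ metrizable ⟹ sequential
compactness suffices); (§2) convergence of the classifying numbers FORCES agewise convergence (indeed uniform convergence of the recursion
variables, by (E44a)'s `|D_j| ≤ C·|D_∞|`), so on solutions of one flow «agewise», «uniform in `1∕h²`» and «in `D_∞`» are ONE notion of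
convergence and `h ↦ D_∞(h, h₀)` is a homeomorphism onto its image in the sequential sense; (§3) that image — the CLASSIFYING SET — is a
compact subset of `[−K, K]` containing `0`, so it has a maximum and a minimum: there is a solution `h⁺` with `D_∞(h, h⁺) ≤ 0` for every
solution `h` (every OTHER solution is eventually STRICTLY ABOVE `h⁺` scale by scale: `h⁺` is the most asymptotically free trajectory from
the pin) and a solution `h⁻` eventually strictly below every other.  Which compact line sets occur: (E38c)'s tent gives two points, (E45a)'s
clamp an interval, both at every ratio above `3√3`; at or below `3√3`, and for monotone non-decreasing memory, the set is one point
((E38a), (E43b)).  AS-PRINTED: nothing (`BetaFlowAsPrinted` is Markov and pointwise, DELTA D-11).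

WHAT IS PROVED ([folklore]; 0 `def`, 0 sorry).  Binder list: zeroth moment `M ≥ 0`, floor `b > 0` on ]0,γ], pin `g_IR ∈ ]0,γ]`.
 §1 **`isCompact_solutionSet`**.
 §2 `tendsto_lim_sub_of_tendsto_limUnder`, **`eventually_forall_abs_disc_le_of_tendsto_limUnder`** (classifying numbers converge ⟹ recursion
    variables converge UNIFORMLY in the scale), **`tendsto_agewise_of_tendsto_limUnder`**, **`agewise_iff_tendsto_limUnder`**.
 §3 `zero_mem_classSet`, `classSet_subset_Icc`, **`isCompact_classSet`**, **`exists_maximal_solution`** ∕ **`exists_minimal_solution`**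
    (`D_∞(h, h⁺) ≤ 0 ≤ D_∞(h, h⁻)` for all solutions `h`), **`eventually_lt_of_ne_maximal`** (every other solution is eventually strictly
    above `h⁺`; node U2's `Sharpness.lt_of_one_div_sq_lt` BY NAME).
 §4 the topological form: **`continuous_restrict_classify`**, **`isClosedEmbedding_restrict_classify`** (`Topology.IsClosedEmbedding` of the
    restriction of `u ↦ limUnder (1∕u² − 1∕h₀²)` to the solution set), **`nonempty_homeomorph_range_classify`** (the solution set is
    HOMEOMORPHIC to its classifying image in `ℝ`).
-/

noncomputable section
open Filter Topology Finset

namespace Summit.QuantumFields.BalabanUV.Beta.EriceRemainderEnclosureHistoryAutonomySolutionSet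

open Literature.MathematicalPhysics.QuantumFieldTheory.Balaban1983to89
open Literature.MathematicalPhysics.QuantumFieldTheory.Balaban1983to89.T4BetaStationary
open Literature.MathematicalPhysics.QuantumFieldTheory.Balaban1983to89.T4BetaFlowWellPosed
open Summit.QuantumFields.BalabanUV.Beta.EriceRemainderEnclosureHistoryAutonomyWellPosed
open Summit.QuantumFields.BalabanUV.Beta.EriceRemainderEnclosureHistoryAutonomyContinuity
open Summit.QuantumFields.BalabanUV.Beta.EriceRemainderEnclosureHistoryAutonomyDiscrepancy
open Summit.QuantumFields.BalabanUV.Beta.EriceRemainderEnclosureHistoryAutonomyAsymptoticDiscrepancy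

variable {B : (ℕ → ℝ) → ℝ} {M γ b gIR : ℝ} {h h₀ : ℕ → ℝ} {hn : ℕ → ℕ → ℝ}

/-! ## §1 The solution set of one flow is compact in the product topology -/

/-- **THE SOLUTION SET IS COMPACT**: for a functional with zeroth moment `M` and floor `b` on ]0,γ] and a pin `g_IR ∈ ]0,γ]`,
`{h | SeqBox γ h ∧ MemFlow B g_IR h}` is a compact subset of `ℕ → ℝ` (product topology) — (E40)'s agewise limit points
(`exists_memFlow_limit_point` with constant functional and pin) + Bolzano–Weierstrass in the metrizable space `ℕ → ℝ`. [folklore] -/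
theorem isCompact_solutionSet
    (hB : ∀ u u' : ℕ → ℝ, SeqBox γ u → SeqBox γ u' → ∀ D : ℝ, (∀ j, |u j - u' j| ≤ D) → |B u - B u'| ≤ M * D)
    (hM : 0 ≤ M) (hb : 0 < b) (hgIR : 0 < gIR) (hgIRγ : gIR ≤ γ) (hlo : ∀ u, SeqBox γ u → b ≤ B u) :
    IsCompact {h : ℕ → ℝ | SeqBox γ h ∧ MemFlow B gIR h} := by
  have hγ : 0 < γ := lt_of_lt_of_le hgIR hgIRγ
  refine IsSeqCompact.isCompact fun hn hmem => ?_
  obtain ⟨h, hh, hf, φ, hφ, hlim⟩ := exists_memFlow_limit_point (Bn := fun _ => B) (gn := fun _ => gIR) (η := fun _ => 0)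
    (hn := hn) hb hγ hB hM (fun _ u hu => hlo u hu) (fun _ u hu => le_upper_zm hB hγ hu) (fun _ u _ => by simp)
    tendsto_const_nhds hgIR (fun _ => ⟨le_rfl, hgIRγ⟩) tendsto_const_nhds (fun n => (hmem n).1) (fun n => (hmem n).2)
  exact ⟨h, ⟨hh, hf⟩, φ, hφ, tendsto_pi_nhds.2 hlim⟩

/-! ## §2 Convergence of the classifying numbers forces agewise (indeed uniform) convergence -/

/-- If the classifying numbers of solutions `h_n` against a reference solution `h₀` converge to that of a solution `h`, then
`D_∞(h_n, h) → 0` (cocycle). [folklore] -/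
theorem tendsto_lim_sub_of_tendsto_limUnder
    (hB : ∀ u u' : ℕ → ℝ, SeqBox γ u → SeqBox γ u' → ∀ D : ℝ, (∀ j, |u j - u' j| ≤ D) → |B u - B u'| ≤ M * D)
    (hM : 0 ≤ M) (hb : 0 < b) (hgIR : 0 < gIR) (hlo : ∀ u, SeqBox γ u → b ≤ B u)
    (hhn : ∀ n, SeqBox γ (hn n)) (hfn : ∀ n, MemFlow B gIR (hn n)) (hh : SeqBox γ h) (hf : MemFlow B gIR h)
    (hh₀ : SeqBox γ h₀) (hf₀ : MemFlow B gIR h₀)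
    (hΦ : Tendsto (fun n => limUnder atTop (fun m => 1 / hn n m ^ 2 - 1 / h₀ m ^ 2)) atTop
      (𝓝 (limUnder atTop (fun m => 1 / h m ^ 2 - 1 / h₀ m ^ 2)))) :
    ∃ dn : ℕ → ℝ, (∀ n, Tendsto (fun m => 1 / hn n m ^ 2 - 1 / h m ^ 2) atTop (𝓝 (dn n))) ∧ Tendsto dn atTop (𝓝 0) := by
  refine ⟨fun n => limUnder atTop (fun m => 1 / hn n m ^ 2 - 1 / h₀ m ^ 2) - limUnder atTop (fun m => 1 / h m ^ 2 - 1 / h₀ m ^ 2),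
    fun n => tendsto_disc_of_ref (tendsto_disc_limUnder hB hM hb hgIR hlo (hhn n) hh₀ (hfn n) hf₀)
      (tendsto_disc_limUnder hB hM hb hgIR hlo hh hh₀ hf hf₀), ?_⟩
  have := hΦ.sub_const (limUnder atTop (fun m => 1 / h m ^ 2 - 1 / h₀ m ^ 2))
  rwa [sub_self] at this

/-- **CLASSIFYING NUMBERS CONVERGE ⟹ THE RECURSION VARIABLES CONVERGE UNIFORMLY IN THE SCALE** (by (E44a)'s `|D_j| ≤ C·|D_∞|`). [folklore] -/
theorem eventually_forall_abs_disc_le_of_tendsto_limUnder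
    (hB : ∀ u u' : ℕ → ℝ, SeqBox γ u → SeqBox γ u' → ∀ D : ℝ, (∀ j, |u j - u' j| ≤ D) → |B u - B u'| ≤ M * D)
    (hM : 0 ≤ M) (hb : 0 < b) (hgIR : 0 < gIR) (hlo : ∀ u, SeqBox γ u → b ≤ B u)
    (hhn : ∀ n, SeqBox γ (hn n)) (hfn : ∀ n, MemFlow B gIR (hn n)) (hh : SeqBox γ h) (hf : MemFlow B gIR h)
    (hh₀ : SeqBox γ h₀) (hf₀ : MemFlow B gIR h₀)
    (hΦ : Tendsto (fun n => limUnder atTop (fun m => 1 / hn n m ^ 2 - 1 / h₀ m ^ 2)) atTop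
      (𝓝 (limUnder atTop (fun m => 1 / h m ^ 2 - 1 / h₀ m ^ 2)))) {ε : ℝ} (hε : 0 < ε) :
    ∀ᶠ n in atTop, ∀ j, |1 / hn n j ^ 2 - 1 / h j ^ 2| ≤ ε := by
  set C : ℝ := Real.exp (3 * M / (2 * (b * Real.sqrt b))) with hC
  have hC0 : 0 < C := Real.exp_pos _
  obtain ⟨dn, hdn, hdn0⟩ := tendsto_lim_sub_of_tendsto_limUnder hB hM hb hgIR hlo hhn hfn hh hf hh₀ hf₀ hΦ
  obtain ⟨N, hN⟩ := (Metric.tendsto_atTop.1 hdn0) (ε / C) (div_pos hε hC0)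
  refine eventually_atTop.2 ⟨N, fun n hNn j => ?_⟩
  have h1 := abs_disc_le_C_mul_abs_lim hB hM hb hgIR hlo (hhn n) hh (hfn n) hf (hdn n) j
  have h2 : |dn n| < ε / C := by have := hN n hNn; rwa [Real.dist_eq, sub_zero] at this
  have e : C * (ε / C) = ε := by field_simp
  calc |1 / hn n j ^ 2 - 1 / h j ^ 2| ≤ C * |dn n| := h1
    _ ≤ C * (ε / C) := mul_le_mul_of_nonneg_left h2.le hC0.le
    _ = ε := e

/-- **CLASSIFYING NUMBERS CONVERGE ⟹ AGEWISE CONVERGENCE** of the solutions themselves (continuity of `x ↦ 1∕√x` at `1∕h(j)² > 0`). [folklore] -/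
theorem tendsto_agewise_of_tendsto_limUnder
    (hB : ∀ u u' : ℕ → ℝ, SeqBox γ u → SeqBox γ u' → ∀ D : ℝ, (∀ j, |u j - u' j| ≤ D) → |B u - B u'| ≤ M * D)
    (hM : 0 ≤ M) (hb : 0 < b) (hgIR : 0 < gIR) (hlo : ∀ u, SeqBox γ u → b ≤ B u)
    (hhn : ∀ n, SeqBox γ (hn n)) (hfn : ∀ n, MemFlow B gIR (hn n)) (hh : SeqBox γ h) (hf : MemFlow B gIR h)
    (hh₀ : SeqBox γ h₀) (hf₀ : MemFlow B gIR h₀)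
    (hΦ : Tendsto (fun n => limUnder atTop (fun m => 1 / hn n m ^ 2 - 1 / h₀ m ^ 2)) atTop
      (𝓝 (limUnder atTop (fun m => 1 / h m ^ 2 - 1 / h₀ m ^ 2)))) (j : ℕ) :
    Tendsto (fun n => hn n j) atTop (𝓝 (h j)) := by
  -- the recursion variables at scale j converge
  have h1 : Tendsto (fun n => 1 / hn n j ^ 2) atTop (𝓝 (1 / h j ^ 2)) := by
    refine Metric.tendsto_atTop.2 fun ε hε => ?_
    obtain ⟨N, hN⟩ := eventually_atTop.1
      (eventually_forall_abs_disc_le_of_tendsto_limUnder hB hM hb hgIR hlo hhn hfn hh hf hh₀ hf₀ hΦ (half_pos hε))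
    exact ⟨N, fun n hNn => by rw [Real.dist_eq]; exact (hN n hNn j).trans_lt (half_lt_self hε)⟩
  -- back to the couplings through `x ↦ 1∕√x`
  have hpos : 0 < 1 / h j ^ 2 := by have := (hh j).1; positivity
  have h2 : Tendsto (fun n => 1 / Real.sqrt (1 / hn n j ^ 2)) atTop (𝓝 (1 / Real.sqrt (1 / h j ^ 2))) :=
    tendsto_const_nhds.div h1.sqrt (Real.sqrt_pos.2 hpos).ne'
  rw [one_div_sqrt_one_div_sq (hh j).1] at h2
  exact h2.congr fun n => one_div_sqrt_one_div_sq (hhn n j).1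

/-- **ONE NOTION OF CONVERGENCE ON THE SOLUTION SET**: for box solutions `h_n, h` of one flow and any reference box solution `h₀`,
`h_n → h` AGEWISE ⟺ `D_∞(h_n, h₀) → D_∞(h, h₀)` — (E44a)'s injective classifying number is a homeomorphism onto its image in the sequential
sense (⟹ is (E44a) `tendsto_limUnder_ref_of_agewise`). [folklore] -/
theorem agewise_iff_tendsto_limUnder
    (hB : ∀ u u' : ℕ → ℝ, SeqBox γ u → SeqBox γ u' → ∀ D : ℝ, (∀ j, |u j - u' j| ≤ D) → |B u - B u'| ≤ M * D)
    (hM : 0 ≤ M) (hb : 0 < b) (hgIR : 0 < gIR) (hlo : ∀ u, SeqBox γ u → b ≤ B u)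
    (hhn : ∀ n, SeqBox γ (hn n)) (hfn : ∀ n, MemFlow B gIR (hn n)) (hh : SeqBox γ h) (hf : MemFlow B gIR h)
    (hh₀ : SeqBox γ h₀) (hf₀ : MemFlow B gIR h₀) :
    (∀ j, Tendsto (fun n => hn n j) atTop (𝓝 (h j))) ↔
      Tendsto (fun n => limUnder atTop (fun m => 1 / hn n m ^ 2 - 1 / h₀ m ^ 2)) atTop
        (𝓝 (limUnder atTop (fun m => 1 / h m ^ 2 - 1 / h₀ m ^ 2))) :=
  ⟨tendsto_limUnder_ref_of_agewise hB hM hb hgIR hlo hhn hfn hh hf hh₀ hf₀,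
    tendsto_agewise_of_tendsto_limUnder hB hM hb hgIR hlo hhn hfn hh hf hh₀ hf₀⟩

/-! ## §3 The classifying set is compact; extremal solutions -/

/-- The classifying set contains `0` (the reference solution itself). [folklore] -/
theorem zero_mem_classSet (hh₀ : SeqBox γ h₀) (hf₀ : MemFlow B gIR h₀) :
    (0 : ℝ) ∈ {d : ℝ | ∃ u : ℕ → ℝ, SeqBox γ u ∧ MemFlow B gIR u ∧
      Tendsto (fun m => 1 / u m ^ 2 - 1 / h₀ m ^ 2) atTop (𝓝 d)} :=
  ⟨h₀, hh₀, hf₀, by simp only [sub_self]; exact tendsto_const_nhds⟩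

/-- The classifying set lies in `[−K, K]`, `K = 10M³∕(b³√b)` ((E43a)). [folklore] -/
theorem classSet_subset_Icc
    (hB : ∀ u u' : ℕ → ℝ, SeqBox γ u → SeqBox γ u' → ∀ D : ℝ, (∀ j, |u j - u' j| ≤ D) → |B u - B u'| ≤ M * D)
    (hM : 0 ≤ M) (hb : 0 < b) (hgIR : 0 < gIR) (hlo : ∀ u, SeqBox γ u → b ≤ B u)
    (hh₀ : SeqBox γ h₀) (hf₀ : MemFlow B gIR h₀) :
    {d : ℝ | ∃ u : ℕ → ℝ, SeqBox γ u ∧ MemFlow B gIR u ∧ Tendsto (fun m => 1 / u m ^ 2 - 1 / h₀ m ^ 2) atTop (𝓝 d)}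
      ⊆ Set.Icc (-(10 * M ^ 3 / (b ^ 3 * Real.sqrt b))) (10 * M ^ 3 / (b ^ 3 * Real.sqrt b)) := by
  rintro d ⟨u, hu, hfu, hd⟩
  exact abs_le.1 (abs_lim_le_K hB hM hb hgIR hlo hu hh₀ hfu hf₀ hd)

/-- **THE CLASSIFYING SET IS COMPACT**: `{D_∞(h, h₀) | h a box solution}` is a compact subset of `ℝ` — a sequence of classifying numbers
has solutions behind it, (E40) extracts an agewise convergent subsequence with a solution as limit, and (E44a) `tendsto_lim_of_agewise` +
the cocycle identify the limit of the numbers with the number of the limit. [folklore] -/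
theorem isCompact_classSet
    (hB : ∀ u u' : ℕ → ℝ, SeqBox γ u → SeqBox γ u' → ∀ D : ℝ, (∀ j, |u j - u' j| ≤ D) → |B u - B u'| ≤ M * D)
    (hM : 0 ≤ M) (hb : 0 < b) (hgIR : 0 < gIR) (hgIRγ : gIR ≤ γ) (hlo : ∀ u, SeqBox γ u → b ≤ B u)
    (hh₀ : SeqBox γ h₀) (hf₀ : MemFlow B gIR h₀) :
    IsCompact {d : ℝ | ∃ u : ℕ → ℝ, SeqBox γ u ∧ MemFlow B gIR u ∧
      Tendsto (fun m => 1 / u m ^ 2 - 1 / h₀ m ^ 2) atTop (𝓝 d)} := by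
  have hγ : 0 < γ := lt_of_lt_of_le hgIR hgIRγ
  refine IsSeqCompact.isCompact fun d hd => ?_
  choose un hun hfun hdn using hd
  obtain ⟨u, hu, hfu, φ, hφ, hlim⟩ := exists_memFlow_limit_point (Bn := fun _ => B) (gn := fun _ => gIR) (η := fun _ => 0)
    (hn := un) hb hγ hB hM (fun _ v hv => hlo v hv) (fun _ v hv => le_upper_zm hB hγ hv) (fun _ v _ => by simp)
    tendsto_const_nhds hgIR (fun _ => ⟨le_rfl, hgIRγ⟩) tendsto_const_nhds hun hfun
  obtain ⟨du, hdu⟩ := exists_tendsto_disc hB hM hb hgIR hlo hu hh₀ hfu hf₀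
  refine ⟨du, ⟨u, hu, hfu, hdu⟩, φ, hφ, ?_⟩
  have h3 : ∀ n, Tendsto (fun m => 1 / un (φ n) m ^ 2 - 1 / u m ^ 2) atTop (𝓝 (d (φ n) - du)) := fun n =>
    tendsto_disc_of_ref (hdn (φ n)) hdu
  have h4 := tendsto_lim_of_agewise (hn := fun n => un (φ n)) hB hM hb hgIR hlo (fun n => hun (φ n)) (fun n => hfun (φ n))
    hu hfu hlim h3
  have h5 := h4.add_const du
  rw [zero_add] at h5
  exact h5.congr fun n => by show d (φ n) - du + du = d (φ n); ring

/-- **THE MAXIMAL SOLUTION**: there is a box solution `h⁺` with `D_∞(h, h⁺) ≤ 0` for EVERY box solution `h` — the largest asymptotic `1∕g²`,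
i.e. the most asymptotically free trajectory from the pin (maximum of the compact classifying set, transported by the cocycle). [folklore] -/
theorem exists_maximal_solution
    (hB : ∀ u u' : ℕ → ℝ, SeqBox γ u → SeqBox γ u' → ∀ D : ℝ, (∀ j, |u j - u' j| ≤ D) → |B u - B u'| ≤ M * D)
    (hM : 0 ≤ M) (hb : 0 < b) (hgIR : 0 < gIR) (hgIRγ : gIR ≤ γ) (hlo : ∀ u, SeqBox γ u → b ≤ B u)
    (hh₀ : SeqBox γ h₀) (hf₀ : MemFlow B gIR h₀) :
    ∃ hp : ℕ → ℝ, SeqBox γ hp ∧ MemFlow B gIR hp ∧ ∀ (u : ℕ → ℝ) (d : ℝ), SeqBox γ u → MemFlow B gIR u →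
      Tendsto (fun m => 1 / u m ^ 2 - 1 / hp m ^ 2) atTop (𝓝 d) → d ≤ 0 := by
  obtain ⟨dmax, ⟨hp, hhp, hfp, hdp⟩, hmax⟩ :=
    (isCompact_classSet hB hM hb hgIR hgIRγ hlo hh₀ hf₀).exists_isGreatest ⟨0, zero_mem_classSet hh₀ hf₀⟩
  refine ⟨hp, hhp, hfp, fun u d hu hfu hd => ?_⟩
  obtain ⟨du, hdu⟩ := exists_tendsto_disc hB hM hb hgIR hlo hu hh₀ hfu hf₀
  have h1 := tendsto_disc_of_ref hdu hdp
  have h2 : d = du - dmax := tendsto_nhds_unique hd h1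
  have h3 : du ≤ dmax := hmax ⟨u, hu, hfu, hdu⟩
  linarith

/-- **THE MINIMAL SOLUTION**: symmetrically, a box solution `h⁻` with `0 ≤ D_∞(h, h⁻)` for every box solution `h`. [folklore] -/
theorem exists_minimal_solution
    (hB : ∀ u u' : ℕ → ℝ, SeqBox γ u → SeqBox γ u' → ∀ D : ℝ, (∀ j, |u j - u' j| ≤ D) → |B u - B u'| ≤ M * D)
    (hM : 0 ≤ M) (hb : 0 < b) (hgIR : 0 < gIR) (hgIRγ : gIR ≤ γ) (hlo : ∀ u, SeqBox γ u → b ≤ B u)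
    (hh₀ : SeqBox γ h₀) (hf₀ : MemFlow B gIR h₀) :
    ∃ hq : ℕ → ℝ, SeqBox γ hq ∧ MemFlow B gIR hq ∧ ∀ (u : ℕ → ℝ) (d : ℝ), SeqBox γ u → MemFlow B gIR u →
      Tendsto (fun m => 1 / u m ^ 2 - 1 / hq m ^ 2) atTop (𝓝 d) → 0 ≤ d := by
  obtain ⟨dmin, ⟨hq, hhq, hfq, hdq⟩, hmin⟩ :=
    (isCompact_classSet hB hM hb hgIR hgIRγ hlo hh₀ hf₀).exists_isLeast ⟨0, zero_mem_classSet hh₀ hf₀⟩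
  refine ⟨hq, hhq, hfq, fun u d hu hfu hd => ?_⟩
  obtain ⟨du, hdu⟩ := exists_tendsto_disc hB hM hb hgIR hlo hu hh₀ hfu hf₀
  have h1 := tendsto_disc_of_ref hdu hdq
  have h2 : d = du - dmin := tendsto_nhds_unique hd h1
  have h3 : dmin ≤ du := hmin ⟨u, hu, hfu, hdu⟩
  linarith

/-- **EVERY OTHER SOLUTION IS EVENTUALLY STRICTLY ABOVE THE MAXIMAL ONE**: with `h⁺` as in `exists_maximal_solution`, a box solution `h ≠ h⁺`
has `h⁺_j < h_j` for all large `j` (its `D_∞(h, h⁺)` is `≤ 0` and `≠ 0`, hence `< 0`, and the discrepancy eventually has that sign).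
[folklore] -/
theorem eventually_lt_of_ne_maximal
    (hB : ∀ u u' : ℕ → ℝ, SeqBox γ u → SeqBox γ u' → ∀ D : ℝ, (∀ j, |u j - u' j| ≤ D) → |B u - B u'| ≤ M * D)
    (hM : 0 ≤ M) (hb : 0 < b) (hgIR : 0 < gIR) (hlo : ∀ u, SeqBox γ u → b ≤ B u) {hp : ℕ → ℝ}
    (hhp : SeqBox γ hp) (hfp : MemFlow B gIR hp)
    (hmax : ∀ (u : ℕ → ℝ) (d : ℝ), SeqBox γ u → MemFlow B gIR u →
      Tendsto (fun m => 1 / u m ^ 2 - 1 / hp m ^ 2) atTop (𝓝 d) → d ≤ 0)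
    (hh : SeqBox γ h) (hf : MemFlow B gIR h) (hne : h ≠ hp) : ∀ᶠ j in atTop, hp j < h j := by
  obtain ⟨d, hd⟩ := exists_tendsto_disc hB hM hb hgIR hlo hh hhp hf hfp
  have hd0 : d < 0 := lt_of_le_of_ne (hmax h d hh hf hd) (lim_ne_zero_of_ne hB hM hb hgIR hlo hh hhp hf hfp hd hne)
  have hev : ∀ᶠ j in atTop, 1 / h j ^ 2 - 1 / hp j ^ 2 < d / 2 :=
    (tendsto_order.1 hd).2 (d / 2) (by linarith)
  exact hev.mono fun j hj => Sharpness.lt_of_one_div_sq_lt (hh j).1 (by linarith)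

/-! ## §4 The topological form: the classifying map is a CLOSED EMBEDDING of the solution set into `ℝ` -/

/-- **THE CLASSIFYING MAP IS CONTINUOUS ON THE SOLUTION SET** (product topology; the solution set is first countable, so sequential
continuity — (E44a) `tendsto_limUnder_ref_of_agewise` — suffices). [folklore] -/
theorem continuous_restrict_classify
    (hB : ∀ u u' : ℕ → ℝ, SeqBox γ u → SeqBox γ u' → ∀ D : ℝ, (∀ j, |u j - u' j| ≤ D) → |B u - B u'| ≤ M * D)
    (hM : 0 ≤ M) (hb : 0 < b) (hgIR : 0 < gIR) (hlo : ∀ u, SeqBox γ u → b ≤ B u)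
    (hh₀ : SeqBox γ h₀) (hf₀ : MemFlow B gIR h₀) :
    Continuous ({u : ℕ → ℝ | SeqBox γ u ∧ MemFlow B gIR u}.restrict
      (fun u : ℕ → ℝ => limUnder atTop (fun m => 1 / u m ^ 2 - 1 / h₀ m ^ 2))) := by
  refine continuous_iff_seqContinuous.2 fun u x hux => ?_
  have hcoe : Tendsto (fun n => ((u n : {u : ℕ → ℝ | SeqBox γ u ∧ MemFlow B gIR u}) : ℕ → ℝ)) atTop
      (𝓝 ((x : {u : ℕ → ℝ | SeqBox γ u ∧ MemFlow B gIR u}) : ℕ → ℝ)) :=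
    (continuous_subtype_val.tendsto x).comp hux
  have hpt : ∀ j, Tendsto (fun n => ((u n : {u : ℕ → ℝ | SeqBox γ u ∧ MemFlow B gIR u}) : ℕ → ℝ) j) atTop
      (𝓝 (((x : {u : ℕ → ℝ | SeqBox γ u ∧ MemFlow B gIR u}) : ℕ → ℝ) j)) := fun j => (tendsto_pi_nhds.1 hcoe) j
  exact tendsto_limUnder_ref_of_agewise (hn := fun n => ((u n : {u : ℕ → ℝ | SeqBox γ u ∧ MemFlow B gIR u}) : ℕ → ℝ))
    hB hM hb hgIR hlo (fun n => (u n).2.1) (fun n => (u n).2.2) x.2.1 x.2.2 hh₀ hf₀ hpt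

/-- **THE CLASSIFYING MAP IS A CLOSED EMBEDDING** of the (compact) solution set into `ℝ`: continuous + injective ((E44a) `injOn_limUnder`) on
a compact space into a Hausdorff space. [folklore] -/
theorem isClosedEmbedding_restrict_classify
    (hB : ∀ u u' : ℕ → ℝ, SeqBox γ u → SeqBox γ u' → ∀ D : ℝ, (∀ j, |u j - u' j| ≤ D) → |B u - B u'| ≤ M * D)
    (hM : 0 ≤ M) (hb : 0 < b) (hgIR : 0 < gIR) (hgIRγ : gIR ≤ γ) (hlo : ∀ u, SeqBox γ u → b ≤ B u)
    (hh₀ : SeqBox γ h₀) (hf₀ : MemFlow B gIR h₀) :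
    Topology.IsClosedEmbedding ({u : ℕ → ℝ | SeqBox γ u ∧ MemFlow B gIR u}.restrict
      (fun u : ℕ → ℝ => limUnder atTop (fun m => 1 / u m ^ 2 - 1 / h₀ m ^ 2))) := by
  haveI : CompactSpace {u : ℕ → ℝ | SeqBox γ u ∧ MemFlow B gIR u} :=
    isCompact_iff_compactSpace.1 (isCompact_solutionSet hB hM hb hgIR hgIRγ hlo)
  exact (continuous_restrict_classify hB hM hb hgIR hlo hh₀ hf₀).isClosedEmbedding
    (Set.injOn_iff_injective.1 (injOn_limUnder hB hM hb hgIR hlo hh₀ hf₀))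

/-- **THE SOLUTION SET IS HOMEOMORPHIC TO A COMPACT SUBSET OF THE LINE** — its image under the classifying map (a subset of `[−K, K]`,
`classSet_subset_Icc`). [folklore] -/
theorem nonempty_homeomorph_range_classify
    (hB : ∀ u u' : ℕ → ℝ, SeqBox γ u → SeqBox γ u' → ∀ D : ℝ, (∀ j, |u j - u' j| ≤ D) → |B u - B u'| ≤ M * D)
    (hM : 0 ≤ M) (hb : 0 < b) (hgIR : 0 < gIR) (hgIRγ : gIR ≤ γ) (hlo : ∀ u, SeqBox γ u → b ≤ B u)
    (hh₀ : SeqBox γ h₀) (hf₀ : MemFlow B gIR h₀) :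
    Nonempty ({u : ℕ → ℝ | SeqBox γ u ∧ MemFlow B gIR u} ≃ₜ
      Set.range ({u : ℕ → ℝ | SeqBox γ u ∧ MemFlow B gIR u}.restrict
        (fun u : ℕ → ℝ => limUnder atTop (fun m => 1 / u m ^ 2 - 1 / h₀ m ^ 2)))) :=
  ⟨(isClosedEmbedding_restrict_classify hB hM hb hgIR hgIRγ hlo hh₀ hf₀).toIsEmbedding.toHomeomorph⟩

end Summit.QuantumFields.BalabanUV.Beta.EriceRemainderEnclosureHistoryAutonomySolutionSet

end
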